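import Mathlib
import HarnessLib
import Summits.HubbardSuperconductivity.HubbardSuperconductivity.Theorems.KLProgrammeKLRegimeEnginePairTransferRelDoor

/-!
# Route `KLProgramme` — ENGINE item stmt-HubbardSuperconductivity-20437, class #5: the relative family's bar WITH A FLAT CUBIC OVERLAP ADDEND — CANDIDATE TEXT for the
# post-FREEZE «AMENDMENT 25 — (X).3-KLTS-CAP + FLAT-CUBIC» door (ii) (plan g23 (R260)(2); cell gate-hubbard-kl, seat hubbard-kl-k3c2-p2 g20; NO role until the pen moves)

WHY.  (R260)(2) takes door (ii) of the located item «(X).3-PINNED-CURRENCY»: at the pinned pair's last step the forward-window `D`-rows leave, after the zero-sound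
cancellation of the kernel's constant part `λ²`, a FLAT cubic source `c₃·(Klam|U|)³` (no `2⁻ⁿ`), ONE TIME PER PAIR; the bar of record
`transferBarRelIdx L G P r β U n m′ = transferBarRelAtWF … (klIdxPrefactor r n) … (klIdxMass n m′) (klIdxOverlap n m′)` has no flat cubic slot.  Since the addend is
pinned-only it rides the OVERLAP weight (`klIdxOverlap n m′ = 15367·[m′ = n]`), so the amendment is a WRAPPER over the DEF-FROZEN `…RelBar`/`…RelBarF`/`…RelBarIdx`
(nothing there is edited), with the flat-cubic coefficient `c₃` a PARAMETER (its value `klC3` is fixed when class #1 / (c) name the λ/W split sizes, bus D5):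
* §1 **`transferBarRelAtWF3 L c₃ G P r β U n ms ov`** `:= transferBarRelAtWF … + r·c₃·(Klam|U|)³·ov`, **`transferBarRelIdx3 L c₃ G P r β U n m′`** (the index-keyed form),
  `transferBarRelIdx3_eq` (`= transferBarRelIdx + klIdxPrefactor r n·c₃·(Klam|U|)³·klIdxOverlap n m′`), `transferBarRelIdx3_of_lt` (history pairs: `= transferBarRelIdx`),
  `transferBarRelIdx_le_transferBarRelIdx3`, nonnegativity;
* §2 **`transferBarRelIdx3_succ_room`** — `transferBarRelIdx_succ_room` with the flat cubic slot `klIdxPrefactor r (n+1)·c₃·(Klam|U|)³·klIdxOverlap (n+1) m′` added to the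
  ROOM (k3c1's (B4) at the pinned pair books the forward rows' cross part `2λ·W` there; history pairs `m′ ≥ n+2` see `0`);
* §3 **`transferBarRelIdx3_pinned_le_succ_shapes`** / **`transferBarRelIdx3_pinned_le_slots`** — the hosting of the PINNED bar (…RelDoor's two lemmas) with the ONE extra
  flat term `+ 2r·15367·c₃·(Klam|U|)³` (`klIdxPrefactor r n ≤ 2r`) — downstream it meets the value lane's re-profiled erem host `Q.CR·(Klam|U|)³·(2⁻ⁿ + klC3)` (bus D4),
  whose ladder sum is `flat_cubic_sum_range_le` (…SplitFlatCubicSum).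
Definitions with bodies + pure real arithmetic over landed lemmas; nothing about the model is asserted; nothing asserts (X).3, (c), K3 or superconductivity.  0 kit · 0 lit.
-/

noncomputable section

namespace Summit.HubbardSuperconductivity.HubbardSuperconductivity.Theorems.KLRegimeSplit

set_option linter.dupNamespace false -- summit = problem name (single-conjunct summit), D-0017

open Real Finset Literature.MathematicalPhysics.QuantumLattice Literature.Probability.LatticeModels
open Summit.HubbardSuperconductivity.HubbardSuperconductivity.Theorems.KLProgrammeLegKernels
open Summit.HubbardSuperconductivity.HubbardSuperconductivity.Theorems.DispersionFlow
open Summit.HubbardSuperconductivity.HubbardSuperconductivity.Theorems.EngineV8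

/-! ## §1 The bar with the flat cubic overlap addend -/

section Defs

variable (L : ℕ)

/-- **`transferBarRelAtWF3 L c₃ G P r β U n ms ov`** — the floor-gained relative bar PLUS the flat cubic overlap addend `r·c₃·(Klam|U|)³·ov` (pinned-only through `ov`). -/
def transferBarRelAtWF3 (c₃ : ℝ) (G : GeoConsts) (P : SplitConsts) (r β U : ℝ) (n : ℕ) (ms ov : ℝ) (Qm k k' : TorusSite 2 L) : ℝ :=
  transferBarRelAtWF L G P r β U n ms ov Qm k k' + r * (c₃ * (P.Klam * |U|) ^ 3 * ov)

/-- **`transferBarRelIdx3 L c₃ G P r β U n m′`** — the index-keyed bar of the pair `(s_{n,m} | s_{n,m′})` with the flat cubic overlap addend: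
`transferBarRelAtWF3` at the prefactor `klIdxPrefactor r n`, the index mass `klIdxMass n m′` and the index overlap `klIdxOverlap n m′`. -/
def transferBarRelIdx3 (c₃ : ℝ) (G : GeoConsts) (P : SplitConsts) (r β U : ℝ) (n m' : ℕ) (Qm k k' : TorusSite 2 L) : ℝ :=
  transferBarRelAtWF3 L c₃ G P (klIdxPrefactor r n) β U n (klIdxMass n m') (klIdxOverlap n m') Qm k k'

variable {L}

/-- Unfolding: `transferBarRelIdx3 = transferBarRelIdx + klIdxPrefactor r n·c₃·(Klam|U|)³·klIdxOverlap n m′`. -/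
theorem transferBarRelIdx3_eq (c₃ : ℝ) (G : GeoConsts) (P : SplitConsts) (r β U : ℝ) (n m' : ℕ) (Qm k k' : TorusSite 2 L) :
    transferBarRelIdx3 L c₃ G P r β U n m' Qm k k' =
      transferBarRelIdx L G P r β U n m' Qm k k' + klIdxPrefactor r n * (c₃ * (P.Klam * |U|) ^ 3 * klIdxOverlap n m') := rfl

/-- **History pairs do not see the addend**: `n < m′ ⇒ transferBarRelIdx3 … n m′ = transferBarRelIdx … n m′`. -/
theorem transferBarRelIdx3_of_lt (c₃ : ℝ) (G : GeoConsts) (P : SplitConsts) (r β U : ℝ) {n m' : ℕ} (h : n < m') (Qm k k' : TorusSite 2 L) :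
    transferBarRelIdx3 L c₃ G P r β U n m' Qm k k' = transferBarRelIdx L G P r β U n m' Qm k k' := by
  rw [transferBarRelIdx3_eq, klIdxOverlap_eq_zero h]; ring

/-- **The PINNED bar carries the flat cubic once**: `transferBarRelIdx3 … n n = transferBarRelIdx … n n + klIdxPrefactor r n·c₃·(Klam|U|)³·15367`. -/
theorem transferBarRelIdx3_self (c₃ : ℝ) (G : GeoConsts) (P : SplitConsts) (r β U : ℝ) (n : ℕ) (Qm k k' : TorusSite 2 L) :
    transferBarRelIdx3 L c₃ G P r β U n n Qm k k' = transferBarRelIdx L G P r β U n n Qm k k' + klIdxPrefactor r n * (c₃ * (P.Klam * |U|) ^ 3 * 15367) := by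
  rw [transferBarRelIdx3_eq, klIdxOverlap_self]

/-- The old bar is below the new one (`0 ≤ c₃`, `0 ≤ r`, `0 ≤ P.Klam`). -/
theorem transferBarRelIdx_le_transferBarRelIdx3 {c₃ : ℝ} (hc : 0 ≤ c₃) (G : GeoConsts) {P : SplitConsts} (hK : 0 ≤ P.Klam) {r : ℝ} (hr : 0 ≤ r) (β U : ℝ)
    (n m' : ℕ) (Qm k k' : TorusSite 2 L) :
    transferBarRelIdx L G P r β U n m' Qm k k' ≤ transferBarRelIdx3 L c₃ G P r β U n m' Qm k k' := by
  rw [transferBarRelIdx3_eq]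
  have h1 := klIdxPrefactor_nonneg hr n
  have h2 := klIdxOverlap_nonneg n m'
  have h3 : 0 ≤ P.Klam * |U| := mul_nonneg hK (abs_nonneg U)
  have : 0 ≤ klIdxPrefactor r n * (c₃ * (P.Klam * |U|) ^ 3 * klIdxOverlap n m') := by positivity
  linarith

/-- Nonnegativity (`0 ≤ c₃`, `0 ≤ r`, `0 ≤ P.Klam`, `0 ≤ G.CF`). -/
theorem transferBarRelIdx3_nonneg {c₃ : ℝ} (hc : 0 ≤ c₃) {G : GeoConsts} (hCF : 0 ≤ G.CF) {P : SplitConsts} (hK : 0 ≤ P.Klam) {r : ℝ} (hr : 0 ≤ r) (β U : ℝ)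
    (n m' : ℕ) (Qm k k' : TorusSite 2 L) : 0 ≤ transferBarRelIdx3 L c₃ G P r β U n m' Qm k k' :=
  (transferBarRelIdx_nonneg hCF hK hr β U n m' Qm k k').trans (transferBarRelIdx_le_transferBarRelIdx3 hc G hK hr β U n m' Qm k k')

end Defs

variable {L : ℕ}

/-! ## §2 The inheritance room with the flat cubic slot -/

/-- **INHERITANCE ROOM with the flat cubic slot** (`0 ≤ G.CF`, `0 ≤ P.Klam`, `0 ≤ r`, any `c₃`, history pair `n+1 ≤ m′`):
`(1 + 2^{−(n+2)})·transferBarRelIdx3(n, m′) + klIdxPrefactor r (n+1)·{ROOM of transferBarRelIdx_succ_room + c₃·(Klam|U|)³·klIdxOverlap (n+1) m′} ≤ transferBarRelIdx3(n+1, m′)` —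
the newborn pinned pair (`m′ = n+1`) gets the flat cubic slot `klIdxPrefactor r (n+1)·c₃·(Klam|U|)³·15367` ONCE; deeper pairs see `0`. -/
theorem transferBarRelIdx3_succ_room (c₃ : ℝ) {G : GeoConsts} (hCF : 0 ≤ G.CF) (P : SplitConsts) (hK : 0 ≤ P.Klam) {r : ℝ} (hr : 0 ≤ r) (β U : ℝ)
    {n m' : ℕ} (hn : n + 1 ≤ m') (Qm k k' : TorusSite 2 L) :
    (1 + ((2 : ℝ) ^ (n + 2))⁻¹) * transferBarRelIdx3 L c₃ G P r β U n m' Qm k k' +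
        klIdxPrefactor r (n + 1) * ((P.Klam * U) ^ 2 *
              ((min (klTorusNorm L (k - k') / klScale klE0 (n + 1)) (klScale klE0 (n + 1) / klTorusNorm L (k - k')) +
                  min (klTorusNorm L (k + k' - Qm) / klScale klE0 (n + 1)) (klScale klE0 (n + 1) / klTorusNorm L (k + k' - Qm)) +
                  ((2 : ℝ) ^ n)⁻¹ + 3 * ((L : ℝ))⁻¹) * klIdxMass n m' + ((4 : ℝ) ^ (n + 1))⁻¹ * klIdxOverlap (n + 1) m') +
            ((P.Klam * |U|) ^ 3 * ((2 : ℝ) ^ n)⁻¹ + 3 * thermalBar G P U β (n + 1)) * klIdxMass n m' +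
            c₃ * (P.Klam * |U|) ^ 3 * klIdxOverlap (n + 1) m') ≤
      transferBarRelIdx3 L c₃ G P r β U (n + 1) m' Qm k k' := by
  have hold := transferBarRelIdx_succ_room (L := L) hCF P hK hr β U hn Qm k k'
  rw [transferBarRelIdx3_of_lt c₃ G P r β U (by omega) Qm k k', transferBarRelIdx3_eq]
  have e : klIdxPrefactor r (n + 1) * ((P.Klam * U) ^ 2 *
              ((min (klTorusNorm L (k - k') / klScale klE0 (n + 1)) (klScale klE0 (n + 1) / klTorusNorm L (k - k')) +
                  min (klTorusNorm L (k + k' - Qm) / klScale klE0 (n + 1)) (klScale klE0 (n + 1) / klTorusNorm L (k + k' - Qm)) +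
                  ((2 : ℝ) ^ n)⁻¹ + 3 * ((L : ℝ))⁻¹) * klIdxMass n m' + ((4 : ℝ) ^ (n + 1))⁻¹ * klIdxOverlap (n + 1) m') +
            ((P.Klam * |U|) ^ 3 * ((2 : ℝ) ^ n)⁻¹ + 3 * thermalBar G P U β (n + 1)) * klIdxMass n m' +
            c₃ * (P.Klam * |U|) ^ 3 * klIdxOverlap (n + 1) m') =
      klIdxPrefactor r (n + 1) * ((P.Klam * U) ^ 2 *
              ((min (klTorusNorm L (k - k') / klScale klE0 (n + 1)) (klScale klE0 (n + 1) / klTorusNorm L (k - k')) +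
                  min (klTorusNorm L (k + k' - Qm) / klScale klE0 (n + 1)) (klScale klE0 (n + 1) / klTorusNorm L (k + k' - Qm)) +
                  ((2 : ℝ) ^ n)⁻¹ + 3 * ((L : ℝ))⁻¹) * klIdxMass n m' + ((4 : ℝ) ^ (n + 1))⁻¹ * klIdxOverlap (n + 1) m') +
            ((P.Klam * |U|) ^ 3 * ((2 : ℝ) ^ n)⁻¹ + 3 * thermalBar G P U β (n + 1)) * klIdxMass n m') +
        klIdxPrefactor r (n + 1) * (c₃ * (P.Klam * |U|) ^ 3 * klIdxOverlap (n + 1) m') := by ring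
  rw [e]
  linarith

/-! ## §3 Hosting of the pinned bar with the flat term -/

/-- **The PINNED bar with the addend, bounded by scale-`(n+1)` shapes** (`transferBarRelIdx_pinned_le_succ_shapes` + the flat term; `0 ≤ r`, `0 ≤ P.Klam`, `0 ≤ Gth.CF`, `0 ≤ c₃`):
`transferBarRelIdx3 L c₃ Gth P r β U n n ≤ 2r·15367·{…succ shapes…} + 2r·15367·c₃·(Klam|U|)³`. -/
theorem transferBarRelIdx3_pinned_le_succ_shapes {c₃ : ℝ} (hc : 0 ≤ c₃) {Gth : GeoConsts} (hCF : 0 ≤ Gth.CF) {P : SplitConsts} (hKl : 0 ≤ P.Klam) {r : ℝ}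
    (hr : 0 ≤ r) (β U : ℝ) (n : ℕ) (Qm k k' : TorusSite 2 L) :
    transferBarRelIdx3 L c₃ Gth P r β U n n Qm k k' ≤
      2 * r * 15367 * ((P.Klam * U) ^ 2 * (4 * (klRelGain (n + 1) (klTorusNorm L (k - k')) + ((2 : ℝ) ^ (n + 1))⁻¹) +
          4 * (klRelGain (n + 1) (klTorusNorm L (k + k' - Qm)) + ((2 : ℝ) ^ (n + 1))⁻¹) + ((L : ℝ))⁻¹) +
        2 * ((P.Klam * |U|) ^ 3 * ((2 : ℝ) ^ (n + 1))⁻¹) + thermalBar Gth P U β (n + 1)) +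
      2 * r * 15367 * (c₃ * (P.Klam * |U|) ^ 3) := by
  rw [transferBarRelIdx3_self]
  have hold := transferBarRelIdx_pinned_le_succ_shapes (L := L) hCF hKl hr β U n Qm k k'
  have hpre := klIdxPrefactor_le hr n
  have h3 : 0 ≤ c₃ * (P.Klam * |U|) ^ 3 * 15367 := by
    have : 0 ≤ P.Klam * |U| := mul_nonneg hKl (abs_nonneg U)
    positivity
  have hflat : klIdxPrefactor r n * (c₃ * (P.Klam * |U|) ^ 3 * 15367) ≤ 2 * r * 15367 * (c₃ * (P.Klam * |U|) ^ 3) := by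
    calc klIdxPrefactor r n * (c₃ * (P.Klam * |U|) ^ 3 * 15367) ≤ (2 * r) * (c₃ * (P.Klam * |U|) ^ 3 * 15367) := mul_le_mul_of_nonneg_right hpre h3
      _ = 2 * r * 15367 * (c₃ * (P.Klam * |U|) ^ 3) := by ring
  linarith

/-- **The PINNED bar with the addend against the engine's slots** (`transferBarRelIdx_pinned_le_slots` at `G = G₀.addShellLog C` + the flat term). -/
theorem transferBarRelIdx3_pinned_le_slots {c₃ : ℝ} (hc : 0 ≤ c₃) {G₀ Gth : GeoConsts} (hph : ∀ n ρ, 0 ≤ G₀.phGain n ρ) (hCF : 0 ≤ Gth.CF) {C : ℝ} (hC : 0 < C)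
    {P : SplitConsts} (hKl : 0 ≤ P.Klam) {r : ℝ} (hr : 0 ≤ r) (β U : ℝ) (n : ℕ) (Qm k k' : TorusSite 2 L) :
    transferBarRelIdx3 L c₃ Gth P r β U n n Qm k k' ≤
      8 * r * 15367 / C * ((P.Klam * U) ^ 2 * ((G₀.addShellLog C).phGain (n + 1) (klTorusNorm L (k - k')) + (G₀.addShellLog C).phGain (n + 1) (klTorusNorm L (k + k' - Qm)))) +
        2 * r * 15367 * ((P.Klam * U) ^ 2 * ((L : ℝ))⁻¹) + 4 * r * 15367 * ((P.Klam * |U|) ^ 3 * ((2 : ℝ) ^ (n + 1))⁻¹) +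
        2 * r * 15367 * thermalBar Gth P U β (n + 1) +
      2 * r * 15367 * (c₃ * (P.Klam * |U|) ^ 3) := by
  rw [transferBarRelIdx3_self]
  have hold := transferBarRelIdx_pinned_le_slots (L := L) hph hCF hC hKl hr β U n Qm k k'
  have hpre := klIdxPrefactor_le hr n
  have h3 : 0 ≤ c₃ * (P.Klam * |U|) ^ 3 * 15367 := by
    have : 0 ≤ P.Klam * |U| := mul_nonneg hKl (abs_nonneg U)
    positivity
  have hflat : klIdxPrefactor r n * (c₃ * (P.Klam * |U|) ^ 3 * 15367) ≤ 2 * r * 15367 * (c₃ * (P.Klam * |U|) ^ 3) := by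
    calc klIdxPrefactor r n * (c₃ * (P.Klam * |U|) ^ 3 * 15367) ≤ (2 * r) * (c₃ * (P.Klam * |U|) ^ 3 * 15367) := mul_le_mul_of_nonneg_right hpre h3
      _ = 2 * r * 15367 * (c₃ * (P.Klam * |U|) ^ 3) := by ring
  linarith

end Summit.HubbardSuperconductivity.HubbardSuperconductivity.Theorems.KLRegimeSplit

end
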